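import Mathlib
import HarnessLib
import Summits.KontsevichZagierPeriods.Zeta5Search.TwoTaleP15GrowthLimit
import Summits.KontsevichZagierPeriods.Zeta5Search.Certificates.LogEnclosures
import Summits.KontsevichZagierPeriods.Zeta5Search.Certificates.LogEnclosuresRecord
import Summits.KontsevichZagierPeriods.Zeta5Search.Certificates.LogEnclosuresSect12

/-!
# TwoTaleP15GrowthEnclosure — the numerical input `C₁* ≤ 42.04` is DISCHARGED: `C₁* ≤ 42.0374`

HONEST FRAMING: systematic search; no irrationality claim unless certified.

fam-measure (pub-zeta5), `families/measure/FAMILY.md` §10.9.  `TwoTaleP15Growth` / `TwoTaleP15GrowthLimit` prove the growth input of the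
P15 measure implication modulo Whipple's identity: `log (qhat n) / n → C₁star := rateΛ ustar`, where `ustar` is SOME
zero of `slopeG` in `[17, 23.9]` chosen by the intermediate value theorem, and leaves the enclosure `C₁star ≤ 42.04`
of the robust record implication `zetaTwo_exponent_le_of_whipple_robust` as a hypothesis.  This file PROVES it,
without locating `ustar`:

* `C₁star_le_tangent` — the SUPPORTING-LINE inequality `C₁star ≤ rateΛ u + ustar·slopeG u` for every `u ∈ (16, 24)`
  (Chernoff's affine upper bound at slopes `tᵢ(u)` evaluated at the critical term `k_n = ⌊ustar·n⌋`, against the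
  file's lower bound `exp_le_taleTwoA_kcrit` for the same term, in the limit `n → ∞`);
* `ustar_window` — if `ustar ≥ 22` then `(ustar − 22)·m ≤ slopeG 22` with `m = 1/2 + 1/4 + 10/109 + 10/89`: each of
  the six logarithmic terms of `slopeG` is antitone on the window, and four of them decrease at an explicit rate
  (`1 − a/b ≤ log b − log a`); since `slopeG ustar = 0` this pins `ustar ≤ 22 + slopeG 22 / m` (numerically
  `ustar = 22.06136`, `22 + slopeG 22/m = 22.07942`);
* numerics ONLY at the rational abscissa `u = 22`, where the eight slope values are `17/29, 12/29, 5/16, 11/16, 9/11,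
  2/11, 7/11, 4/11`: the cell's certified enclosures of `log 2, 4, 5, 7, 9, 11, 12, 16, 17`
  (`Certificates/LogEnclosures{,Record,Sect12}`) plus `log 29` (proved here from `29 = 30·(1 − 1/30)`, 12 terms)
  give `0 ≤ slopeG 22 ≤ 0.07577863` and `rateΛ 22 + 22·slopeG 22 ≤ 42.0312864`, whence
  **`C₁star_le : C₁star ≤ 42.0374`** (`= 42.0312864 + 0.0794241·0.07577863`; the true value is `42.03361581…`);
* packaged, with NO numerical hypothesis left on the growth side:
  **`zetaTwo_exponent_le_of_whipple₃ : Inclusion → Decay 29.10787 → WhippleP15 → ExponentLE (zetaValue 2) 5.0499 ∧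
  Zudilin2014.zetaTwo_irrationalityExponent_le`** and the robust
  **`zetaTwo_exponent_le_of_whipple₃_robust : Inclusion → Decay 29.1 → WhippleP15 → ExponentLE (zetaValue 2) 5.0521 ∧ …`**.

NOTHING here certifies a measure: `Inclusion`, `Decay` ((bmiss) at P15 + the line-integral bound) and `WhippleP15`
remain named inputs (see `TwoTaleP15Growth`).  The sharp design exponent `5.0496` needs `C₁star ≤ 42.033616`, i.e. a
window of width `≈ 10⁻⁴` around `ustar`; the one-point argument here gives width `0.08` and costs `3·10⁻⁴` in `μ`.
References: W. Zudilin, arXiv:1310.1526 [Zudilin2014ZetaTwo] §6, Remark 5 (the partner parameters); the enclosure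
method is the cell's (`Certificates/LogEnclosures`, `Mathlib`'s `Real.abs_log_sub_add_sum_range_le`).
-/

noncomputable section

open Filter Topology Finset Real

namespace Summit.KontsevichZagierPeriods.Zeta5Search.TwoTaleP15Growth

open Summit.KontsevichZagierPeriods.Zeta5Search.LogEnclosures (log_one_sub_bounds log_two_bounds log_three_bounds
  log_five_bounds log_4_bounds log_9_bounds log_12_bounds log_16_bounds log_7_bounds log_11_bounds log_17_bounds)

/-! ### (a) The supporting-line inequality -/

/-- **Supporting line:** for every `u` in the window, `C₁* ≤ Λ(u) + ustar·G(u)` — the Chernoff tangent plane at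
slopes `tᵢ(u)` lies above the max-term entropy, in particular above its value `C₁*` at the critical abscissa. -/
theorem C₁star_le_tangent {u : ℝ} (hu : 16 < u) (hu' : u < 24) : C₁star ≤ rateΛ u + ustar * slopeG u := by
  have hA : Tendsto (fun n : ℕ => (constK ustar - penP - 8) / (n : ℝ)) atTop (𝓝 0) :=
    tendsto_const_div_atTop_nhds_zero_nat _
  have hB : Tendsto (fun n : ℕ => Real.log (33 * n + 0) / (n : ℝ)) atTop (𝓝 0) :=
    tendsto_log_linear_div (by norm_num) le_rfl
  have hlo : Tendsto (fun n : ℕ => C₁star + ((constK ustar - penP - 8) / (n : ℝ) - 2 * (Real.log (33 * n + 0) / n)))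
      atTop (𝓝 C₁star) := by
    simpa using tendsto_const_nhds.add (hA.sub (hB.const_mul 2))
  have hhi : Tendsto (fun n : ℕ => (rateΛ u + ustar * slopeG u) + (|slopeG u| + constK u) / (n : ℝ)) atTop
      (𝓝 (rateΛ u + ustar * slopeG u)) := by
    simpa using tendsto_const_nhds.add (tendsto_const_div_atTop_nhds_zero_nat (|slopeG u| + constK u))
  refine le_of_tendsto_of_tendsto hlo hhi ?_
  filter_upwards [eventually_ge_atTop 1] with n hn
  have hnpos : (0:ℝ) < n := by exact_mod_cast hn
  have h1 := exp_le_taleTwoA_kcrit hn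
  have hk : 15 * n + 1 ≤ kcrit n := by have := (kcrit_range hn).1; omega
  have h2 := taleTwoA_le_exp n (kcrit n) hk hu hu'
  have h12 := Real.exp_le_exp.mp (h1.trans h2)
  obtain ⟨hx0, hx1⟩ := kcrit_real n
  have hkG : (kcrit n : ℝ) * slopeG u ≤ ustar * n * slopeG u + |slopeG u| := by
    have hd : |((kcrit n : ℝ) - ustar * n)| ≤ 1 := by rw [abs_le]; constructor <;> linarith
    have h3 : |((kcrit n : ℝ) - ustar * n) * slopeG u| ≤ |slopeG u| := by
      rw [abs_mul]; exact mul_le_of_le_one_left (abs_nonneg _) hd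
    have h4 := (abs_le.mp h3).2
    linarith
  rw [add_zero]
  have e1 : C₁star + ((constK ustar - penP - 8) / (n : ℝ) - 2 * (Real.log (33 * n) / n)) =
      (n * C₁star + constK ustar - penP - 2 * Real.log (33 * n) - 8) / n := by
    field_simp; ring
  have e2 : rateΛ u + ustar * slopeG u + (|slopeG u| + constK u) / (n : ℝ) =
      (n * rateΛ u + ustar * n * slopeG u + |slopeG u| + constK u) / n := by
    field_simp; ring
  rw [e1, e2]
  exact div_le_div_of_nonneg_right (by linarith) hnpos.le

/-! ### (b) The one-sided window for `ustar` -/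

/-- `1 − a/b ≤ log b − log a` (the tangent-line bound `log x ≤ x − 1` at `x = a/b`). -/
theorem one_sub_div_le_log_sub_log {a b : ℝ} (ha : 0 < a) (hb : 0 < b) :
    1 - a / b ≤ Real.log b - Real.log a := by
  have h := Real.log_le_sub_one_of_pos (div_pos ha hb)
  rw [Real.log_div ha.ne' hb.ne'] at h
  linarith

/-- **Window:** if `ustar ≥ 22` then `(ustar − 22)·(1/2 + 1/4 + 10/109 + 10/89) ≤ slopeG 22`.  All six logarithmic
terms of `slopeG` are antitone on `(16, 24)`; the terms `log(1 − t₂)`, `log(1 − t₃)`, `−log t₂`, `−log t₃` drop between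
`22` and `ustar` by at least `(ustar−22)/2`, `(ustar−22)/4`, `(ustar−22)·10/109`, `(ustar−22)·10/89`, and
`slopeG ustar = 0`. -/
theorem ustar_window (h22 : 22 ≤ ustar) : (ustar - 22) * (1 / 2 + 1 / 4 + 10 / 109 + 10 / 89) ≤ slopeG 22 := by
  have hroot : slopeG ustar = 0 := ustar_spec.2
  have hu2 : ustar ≤ 239 / 10 := ustar_spec.1.2
  obtain ⟨hu16, hu24⟩ := ustar_bounds
  obtain ⟨⟨a0, b0⟩, ⟨a1, b1⟩, ⟨a2, b2⟩, ⟨a3, b3⟩⟩ := slopes_mem hu16 hu24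
  have eG22 : slopeG 22 = -2 * Real.log (12 / 29) - Real.log (11 / 16) - Real.log (9 / 11) + Real.log (2 / 11) -
      Real.log (7 / 11) + Real.log (4 / 11) := by
    unfold slopeG t₀ t₁ t₂ t₃; norm_num
  have eGu : slopeG ustar = -2 * Real.log (1 - t₀ ustar) - Real.log (1 - t₁ ustar) - Real.log (t₂ ustar) +
      Real.log (1 - t₂ ustar) - Real.log (t₃ ustar) + Real.log (1 - t₃ ustar) := rfl
  have hprod : 0 ≤ (ustar - 22) * (239 / 10 - ustar) := mul_nonneg (by linarith) (by linarith)
  -- T1, T2: antitone (no rate needed)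
  have T1 : Real.log (12 / 29) ≤ Real.log (1 - t₀ ustar) := by
    apply Real.log_le_log (by norm_num)
    have : 17 / (2 * ustar - 15) ≤ 17 / 29 := div_le_div_of_nonneg_left (by norm_num) (by norm_num) (by linarith)
    unfold t₀; linarith
  have T2 : Real.log (11 / 16) ≤ Real.log (1 - t₁ ustar) := by
    apply Real.log_le_log (by norm_num)
    have : 5 / (ustar - 6) ≤ 5 / 16 := div_le_div_of_nonneg_left (by norm_num) (by norm_num) (by linarith)
    unfold t₁; linarith
  -- T3: −log t₂ drops by ≥ (ustar−22)·10/109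
  have T3 : (ustar - 22) * (10 / 109) ≤ Real.log (t₂ ustar) - Real.log (9 / 11) := by
    have h := one_sub_div_le_log_sub_log (by norm_num : (0:ℝ) < 9 / 11) a2
    have h' : (9 / 11) / t₂ ustar ≤ 1 - (ustar - 22) * (10 / 109) := by
      rw [div_le_iff₀ a2]; unfold t₂; nlinarith [hprod]
    linarith
  -- T4: log(1 − t₂) drops by ≥ (ustar−22)/2
  have T4 : (ustar - 22) / 2 ≤ Real.log (2 / 11) - Real.log (1 - t₂ ustar) := by
    have h := one_sub_div_le_log_sub_log (by linarith : (0:ℝ) < 1 - t₂ ustar) (by norm_num : (0:ℝ) < 2 / 11)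
    have e : 1 - (1 - t₂ ustar) / (2 / 11) = (ustar - 22) / 2 := by unfold t₂; ring
    linarith
  -- T5: −log t₃ drops by ≥ (ustar−22)·10/89
  have T5 : (ustar - 22) * (10 / 89) ≤ Real.log (t₃ ustar) - Real.log (7 / 11) := by
    have h := one_sub_div_le_log_sub_log (by norm_num : (0:ℝ) < 7 / 11) a3
    have h' : (7 / 11) / t₃ ustar ≤ 1 - (ustar - 22) * (10 / 89) := by
      rw [div_le_iff₀ a3]; unfold t₃; nlinarith [hprod]
    linarith
  -- T6: log(1 − t₃) drops by ≥ (ustar−22)/4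
  have T6 : (ustar - 22) / 4 ≤ Real.log (4 / 11) - Real.log (1 - t₃ ustar) := by
    have h := one_sub_div_le_log_sub_log (by linarith : (0:ℝ) < 1 - t₃ ustar) (by norm_num : (0:ℝ) < 4 / 11)
    have e : 1 - (1 - t₃ ustar) / (4 / 11) = (ustar - 22) / 4 := by unfold t₃; ring
    linarith
  rw [eG22]
  rw [eGu] at hroot
  linarith

/-! ### (c) Certified numerics at `u = 22` -/

/-- `log 29` to 12 decimals (`29 = 2·3·5·(1 − 1/30)`, 12 terms of the series). -/
theorem log_29_bounds : (3.367295829986 : ℝ) ≤ Real.log 29 ∧ Real.log 29 ≤ 3.367295829987 := by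
  have hx : |(1 / 30 : ℝ)| < 1 := by rw [abs_of_pos (by norm_num : (0 : ℝ) < 1 / 30)]; norm_num
  have h := log_one_sub_bounds hx 12
  rw [abs_of_pos (by norm_num : (0 : ℝ) < 1 / 30)] at h
  simp only [sum_range_succ, sum_range_zero] at h
  norm_num at h
  have hN : Real.log (29 : ℝ) = Real.log 2 + Real.log 3 + Real.log 5 + Real.log (1 - 1 / 30) := by
    rw [show (29 : ℝ) = 2 * 3 * 5 * (1 - 1 / 30) by norm_num]
    rw [Real.log_mul (by norm_num) (by norm_num), Real.log_mul (by norm_num) (by norm_num),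
      Real.log_mul (by norm_num) (by norm_num)]
  obtain ⟨p1, p2⟩ := log_two_bounds
  obtain ⟨q1, q2⟩ := log_three_bounds
  obtain ⟨r1, r2⟩ := log_five_bounds
  rw [hN]
  constructor <;> linarith [h.1, h.2]

/-- The three certified inequalities at `u = 22`: `0 ≤ slopeG 22 ≤ 0.07577863` and
`rateΛ 22 + 22·slopeG 22 ≤ 42.0312864` (true values `0.0757786251…`, `42.0312863726…`). -/
theorem numerics_at_22 :
    0 ≤ slopeG 22 ∧ slopeG 22 ≤ 0.07577863 ∧ rateΛ 22 + 22 * slopeG 22 ≤ 42.0312864 := by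
  have eG : slopeG 22 = -2 * Real.log (12 / 29) - Real.log (11 / 16) - Real.log (9 / 11) + Real.log (2 / 11) -
      Real.log (7 / 11) + Real.log (4 / 11) := by
    unfold slopeG t₀ t₁ t₂ t₃; norm_num
  have eΛ : rateΛ 22 = -17 * Real.log (17 / 29) + 32 * Real.log (12 / 29) - 5 * Real.log (5 / 16) +
      11 * Real.log (11 / 16) + 13 * Real.log (9 / 11) - 24 * Real.log (2 / 11) + 15 * Real.log (7 / 11) -
      26 * Real.log (4 / 11) := by
    unfold rateΛ t₀ t₁ t₂ t₃; norm_num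
  have d1 : Real.log (17 / 29) = Real.log 17 - Real.log 29 := Real.log_div (by norm_num) (by norm_num)
  have d2 : Real.log (12 / 29) = Real.log 12 - Real.log 29 := Real.log_div (by norm_num) (by norm_num)
  have d3 : Real.log (5 / 16) = Real.log 5 - Real.log 16 := Real.log_div (by norm_num) (by norm_num)
  have d4 : Real.log (11 / 16) = Real.log 11 - Real.log 16 := Real.log_div (by norm_num) (by norm_num)
  have d5 : Real.log (9 / 11) = Real.log 9 - Real.log 11 := Real.log_div (by norm_num) (by norm_num)
  have d6 : Real.log (2 / 11) = Real.log 2 - Real.log 11 := Real.log_div (by norm_num) (by norm_num)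
  have d7 : Real.log (7 / 11) = Real.log 7 - Real.log 11 := Real.log_div (by norm_num) (by norm_num)
  have d8 : Real.log (4 / 11) = Real.log 4 - Real.log 11 := Real.log_div (by norm_num) (by norm_num)
  obtain ⟨p1, p2⟩ := log_two_bounds
  obtain ⟨f1, f2⟩ := log_4_bounds
  obtain ⟨r1, r2⟩ := log_five_bounds
  obtain ⟨s1, s2⟩ := log_7_bounds
  obtain ⟨n1, n2⟩ := log_9_bounds
  obtain ⟨e1, e2⟩ := log_11_bounds
  obtain ⟨w1, w2⟩ := log_12_bounds
  obtain ⟨x1, x2⟩ := log_16_bounds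
  obtain ⟨v1, v2⟩ := log_17_bounds
  obtain ⟨y1, y2⟩ := log_29_bounds
  rw [eG, eΛ, d1, d2, d3, d4, d5, d6, d7, d8]
  refine ⟨by linarith, by linarith, by linarith⟩

/-! ### (d) The enclosure and the hypothesis-free packaging -/

/-- **`C₁* ≤ 42.0374`** (true value `42.03361581…`): supporting line at `u = 22` plus the window. -/
theorem C₁star_le : C₁star ≤ 42.0374 := by
  have ht := C₁star_le_tangent (by norm_num : (16:ℝ) < 22) (by norm_num : (22:ℝ) < 24)
  obtain ⟨g0, g1, hH⟩ := numerics_at_22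
  rcases le_or_gt ustar 22 with h | h
  · have : ustar * slopeG 22 ≤ 22 * slopeG 22 := mul_le_mul_of_nonneg_right h g0
    linarith
  · have hw := ustar_window h.le
    have hx : ustar - 22 ≤ 0.0794241 := by linarith
    have hxG : (ustar - 22) * slopeG 22 ≤ 0.0794241 * 0.07577863 :=
      mul_le_mul hx g1 g0 (by norm_num)
    nlinarith

/-- The coarse enclosure used by `TwoTaleP15Growth.zetaTwo_exponent_le_of_whipple_robust`. -/
theorem C₁star_le_42_04 : C₁star ≤ 42.04 := by linarith [C₁star_le]

section Packaged

open Literature.NumberTheory.Irrationality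
open Literature.NumberTheory.Transcendental (zetaValue)
open Summit.KontsevichZagierPeriods.Zeta5Search.Denom.TwoTaleP15Saving (savingRate savingRate_bounds)
open Summit.KontsevichZagierPeriods.Zeta5Search.Denom.TwoTaleP15Forms (Inclusion Decay)

/-- **P15, three inputs, design decay constant:** `Inclusion → Decay 29.10787 → WhippleP15 → μ(ζ(2)) ≤ 5.0499`
(`< 5.09541178`, the 2014 record; the design value with the exact `C₁*` is `5.04952429`). -/
theorem zetaTwo_exponent_le_of_whipple₃ (hI : Inclusion) (hD : Decay 29.10787) (hW : WhippleP15) :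
    ExponentLE (zetaValue 2) 5.0499 ∧ Zudilin2014.zetaTwo_irrationalityExponent_le := by
  have hS := savingRate_bounds
  have hC := C₁star_le
  have h := exponentLE_of_whipple hI hD hW (by linarith [hS.1])
  have hden : 0 < 29.10787 - (31 - savingRate) := by linarith [hS.1]
  have hle : 1 + (C₁star + (31 - savingRate)) / (29.10787 - (31 - savingRate)) ≤ 5.0499 := by
    have h1 : (C₁star + (31 - savingRate)) / (29.10787 - (31 - savingRate)) ≤ 4.0499 := by
      rw [div_le_iff₀ hden]; nlinarith [hS.1]
    linarith
  have h' : ExponentLE (zetaValue 2) 5.0499 := h.mono hle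
  exact ⟨h', (zetaTwo_record_of_exponentLE h' (by norm_num)).1⟩

/-- **P15, three inputs, robust decay constant:** `Inclusion → Decay 29.1 → WhippleP15 → μ(ζ(2)) ≤ 5.0521`. -/
theorem zetaTwo_exponent_le_of_whipple₃_robust (hI : Inclusion) (hD : Decay 29.1) (hW : WhippleP15) :
    ExponentLE (zetaValue 2) 5.0521 ∧ Zudilin2014.zetaTwo_irrationalityExponent_le := by
  have hS := savingRate_bounds
  have hC := C₁star_le
  have h := exponentLE_of_whipple hI hD hW (by linarith [hS.1])
  have hden : 0 < 29.1 - (31 - savingRate) := by linarith [hS.1]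
  have hle : 1 + (C₁star + (31 - savingRate)) / (29.1 - (31 - savingRate)) ≤ 5.0521 := by
    have h1 : (C₁star + (31 - savingRate)) / (29.1 - (31 - savingRate)) ≤ 4.0521 := by
      rw [div_le_iff₀ hden]; nlinarith [hS.1]
    linarith
  have h' : ExponentLE (zetaValue 2) 5.0521 := h.mono hle
  exact ⟨h', (zetaTwo_record_of_exponentLE h' (by norm_num)).1⟩

/-- The robust implication of `TwoTaleP15Growth` with its enclosure hypothesis discharged. -/
theorem zetaTwo_exponent_le_of_whipple_robust' (hI : Inclusion) (hD : Decay 29.1) (hW : WhippleP15) :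
    ExponentLE (zetaValue 2) 5.0523 ∧ Zudilin2014.zetaTwo_irrationalityExponent_le :=
  zetaTwo_exponent_le_of_whipple_robust hI hD hW C₁star_le_42_04

end Packaged

end Summit.KontsevichZagierPeriods.Zeta5Search.TwoTaleP15Growth

end
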